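import Summits.QuantumAdvantage.QuantumAdvantage.Theorems.CubicForrelationNearExactIsExactTwelveTypeOPairTame

/-!
# Crux `CubicForrelation.NearExactIsExact` (stmt-QuantumAdvantage-14043) — n = 12, TYPE-O × TYPE-O pairs WITH WILD POINTS: the general
  MASTER IDENTITY, the weight formula, and `v̂ ∈ 4ℤ` for the wild function

Certificate seat `b2b-cforr-cert` (gen 30).  HONEST FRAMING: kernel-checked finite-slice identities (standard axioms) about cubic Boolean pairs on 12
bits; infrastructure for the only configuration left on the open window `(57/64, 29/32)` after `tz30_window_pair_typeO` and `top_tame_false`: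
an (O,O) pair with a wild point.  NO new value of `θ₁₂`; nothing is excluded here; NOT summit progress.  Plan: HOME/b2b-cforr-cert-g30/PLAN-N12-WINDOW-OO.md.

Setting as in …TwelveTypeOPairTame, now with WILD functions: `τᵢ = (−1)^{bᵢ}(−1)^{cᵢ·x}(1 − 4·[κᵢ x]) + 8vᵢ(x)` (`to12_pt_mod8`, `stub_affineForm`).
* `topw_master` (**general master identity**): for every `y`,
  `Σ_{x : κ₁ x} (−1)^{x·(c₁⊕y)} = 1024·[y = c₁] + 16(−1)^{b₁+b₂}(−1)^{c₂·y}(1 − 4·[κ₂ y]) + 2(−1)^{b₁} Σ_x v₁(x)(−1)^{x·y} + 128(−1)^{b₁} v₂(y)`.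
* `topw_card`: `#E₁ = 1024 + 16(−1)^{b₁+b₂+c₁·c₂}(1 − 4·[κ₂ c₁]) + 2(−1)^{b₁}Σ_x v₁(x)(−1)^{x·c₁} + 128(−1)^{b₁}v₂(c₁)` (the identity at `y = c₁`).
* `topw_vhat_dvd4`: `4 ∣ Σ_x v₁(x)(−1)^{x·y}` for every `y` — the wild function lies in the lattice `M₂` of integer functions with Fourier
  coefficients in `4ℤ` (so wild points come in 2-flat packets: `Σ v₁ ≡ 0 (mod 4)` on the whole space, etc.).  [`1̂_{E₁} ∈ 8ℤ` because `κ₁` is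
  cubic (`tw_base`), and the master identity.]

References: J. Ax (1964) / R. J. McEliece (1972); C. Carlet (2021) §2.3; R. O'Donnell (2014) §1.4.  Axioms: the standard three.
-/

set_option linter.dupNamespace false -- D-0017: single-problem summit ⇒ `QuantumAdvantage.QuantumAdvantage` by design

noncomputable section

namespace Summit.QuantumAdvantage.QuantumAdvantage.Theorems.CubicForrelation.NearExactIsExact

open Finset
open Literature.Computability.QuantumComplexity
open Literature.Computability.QuantumComplexity.BuzetChailloux (bxor zeroVec bxor_bxor_cancel_left bxor_zeroVec zeroVec_bxor bxor_comm
  bxor_self twist_bxor_right twist_zeroVec_right sum_twist_left bxor_eq_zeroVec_iff)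
open Literature.Computability.QuantumComplexity.DerivativeWalsh (W)

/-- **General master identity of an (O,O) pair.**  `W_{F₁} = 16u₁`, `W_{F₂} = 16u₂` (any Boolean `F₁, F₂` on 12 bits) and decompositions
`u₁ − 4(−1)^{F₂} = (−1)^{b₁}(−1)^{c₁·x}(1 − 4[κ₁ x]) + 8v₁(x)`, `u₂ − 4(−1)^{F₁} = (−1)^{b₂}(−1)^{c₂·y}(1 − 4[κ₂ y]) + 8v₂(y)` (real form) give, for
every `y`: `Σ_{x : κ₁ x} (−1)^{x·(c₁⊕y)} = 1024·[y = c₁] + 16(−1)^{b₁}(−1)^{b₂}(−1)^{c₂·y}(1 − 4[κ₂ y]) + 2(−1)^{b₁}Σ_x v₁(x)(−1)^{x·y} + 128(−1)^{b₁}v₂(y)`.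
[this work] -/
theorem topw_master (F₁ F₂ : (Fin (6 + 6) → Bool) → Bool) (u₁ u₂ v₁ v₂ : (Fin (6 + 6) → Bool) → ℤ)
    (hu₁ : ∀ x, W (fun y => signOf (F₁ y)) x = (2 : ℝ) ^ 4 * (u₁ x : ℝ))
    (hu₂ : ∀ y, W (fun x => signOf (F₂ x)) y = (2 : ℝ) ^ 4 * (u₂ y : ℝ))
    (κ₁ κ₂ : (Fin (6 + 6) → Bool) → Bool) (b₁ b₂ : Bool) (c₁ c₂ : Fin (6 + 6) → Bool)
    (h₁ : ∀ x, (((u₁ x - 4 * sZ (F₂ x) : ℤ)) : ℝ) = signOf b₁ * twist c₁ x * (1 - 4 * (if κ₁ x = true then 1 else 0)) + 8 * (v₁ x : ℝ))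
    (h₂ : ∀ y, (((u₂ y - 4 * sZ (F₁ y) : ℤ)) : ℝ) = signOf b₂ * twist c₂ y * (1 - 4 * (if κ₂ y = true then 1 else 0)) + 8 * (v₂ y : ℝ))
    (y : Fin (6 + 6) → Bool) :
    ∑ x ∈ univ.filter (fun x => κ₁ x = true), twist x (bxor c₁ y) =
      1024 * (if y = c₁ then 1 else 0) + 16 * (signOf b₁ * signOf b₂) * twist c₂ y * (1 - 4 * (if κ₂ y = true then 1 else 0)) +
        2 * signOf b₁ * ∑ x, (v₁ x : ℝ) * twist x y + 128 * signOf b₁ * (v₂ y : ℝ) := by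
  classical
  have hd := top_duality F₁ F₂ u₁ u₂ hu₁ hu₂ y
  rw [h₂ y, sum_congr rfl fun x _ => by rw [h₁ x]] at hd
  have htw : ∀ x, twist c₁ x * twist x y = twist x (bxor c₁ y) := fun x => by
    rw [Literature.Computability.QuantumComplexity.twist_comm c₁ x, twist_bxor_right]
  have hsplit : ∑ x, (signOf b₁ * twist c₁ x * (1 - 4 * (if κ₁ x = true then (1 : ℝ) else 0)) + 8 * (v₁ x : ℝ)) * twist x y =
      signOf b₁ * (∑ x, twist x (bxor c₁ y) - 4 * ∑ x ∈ univ.filter (fun x => κ₁ x = true), twist x (bxor c₁ y)) +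
        8 * ∑ x, (v₁ x : ℝ) * twist x y := by
    rw [sum_filter]
    simp only [mul_sum, mul_sub]
    rw [← sum_sub_distrib, ← sum_add_distrib]
    refine sum_congr rfl fun x _ => ?_
    rw [← htw x]
    split_ifs <;> ring
  rw [hsplit, sum_twist_left] at hd
  have hδ : (if bxor c₁ y = zeroVec then (2 : ℝ) ^ (6 + 6) else 0) = 4096 * (if y = c₁ then 1 else 0) := by
    by_cases hy : y = c₁
    · rw [if_pos hy, if_pos ((bxor_eq_zeroVec_iff c₁ y).2 hy.symm)]; norm_num
    · rw [if_neg hy, if_neg (fun h => hy ((bxor_eq_zeroVec_iff c₁ y).1 h).symm)]; norm_num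
  rw [hδ] at hd
  have hs1 : signOf b₁ * signOf b₁ = 1 := by cases b₁ <;> simp [signOf]
  linear_combination (-(signOf b₁) / 4) * hd -
    (∑ x ∈ univ.filter (fun x => κ₁ x = true), twist x (bxor c₁ y) - 1024 * (if y = c₁ then (1 : ℝ) else 0)) * hs1

/-- **Weight formula of an (O,O) pair** (the master identity at `y = c₁`): `#E₁ = 1024 + 16(−1)^{b₁}(−1)^{b₂}(−1)^{c₂·c₁}(1 − 4[κ₂ c₁]) +
2(−1)^{b₁}Σ_x v₁(x)(−1)^{x·c₁} + 128(−1)^{b₁}v₂(c₁)`. [this work] -/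
theorem topw_card (F₁ F₂ : (Fin (6 + 6) → Bool) → Bool) (u₁ u₂ v₁ v₂ : (Fin (6 + 6) → Bool) → ℤ)
    (hu₁ : ∀ x, W (fun y => signOf (F₁ y)) x = (2 : ℝ) ^ 4 * (u₁ x : ℝ))
    (hu₂ : ∀ y, W (fun x => signOf (F₂ x)) y = (2 : ℝ) ^ 4 * (u₂ y : ℝ))
    (κ₁ κ₂ : (Fin (6 + 6) → Bool) → Bool) (b₁ b₂ : Bool) (c₁ c₂ : Fin (6 + 6) → Bool)
    (h₁ : ∀ x, (((u₁ x - 4 * sZ (F₂ x) : ℤ)) : ℝ) = signOf b₁ * twist c₁ x * (1 - 4 * (if κ₁ x = true then 1 else 0)) + 8 * (v₁ x : ℝ))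
    (h₂ : ∀ y, (((u₂ y - 4 * sZ (F₁ y) : ℤ)) : ℝ) = signOf b₂ * twist c₂ y * (1 - 4 * (if κ₂ y = true then 1 else 0)) + 8 * (v₂ y : ℝ)) :
    (#(univ.filter (fun x => κ₁ x = true)) : ℝ) =
      1024 + 16 * (signOf b₁ * signOf b₂) * twist c₂ c₁ * (1 - 4 * (if κ₂ c₁ = true then 1 else 0)) +
        2 * signOf b₁ * ∑ x, (v₁ x : ℝ) * twist x c₁ + 128 * signOf b₁ * (v₂ c₁ : ℝ) := by
  classical
  have h := topw_master F₁ F₂ u₁ u₂ v₁ v₂ hu₁ hu₂ κ₁ κ₂ b₁ b₂ c₁ c₂ h₁ h₂ c₁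
  rw [bxor_self, if_pos rfl, sum_congr rfl fun x _ => twist_zeroVec_right x, sum_const, nsmul_eq_mul, mul_one] at h
  rw [h]
  ring

/-- **The wild function has Fourier coefficients in `4ℤ`.**  In the setting of `topw_master` with `κ₁` CUBIC: `Σ_x v₁(x)(−1)^{x·y} = 4k`
with `k ∈ ℤ`, for every `y`.  [`Σ_{E₁}(−1)^{x·z} = 2048[z = 0] − 8w(z)` with `W_{κ₁} = 16w` (`tw_base`), and every other term of the master
identity is in `8ℤ`.] [this work] -/
theorem topw_vhat_dvd4 (F₁ F₂ : (Fin (6 + 6) → Bool) → Bool) (u₁ u₂ v₁ v₂ : (Fin (6 + 6) → Bool) → ℤ)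
    (hu₁ : ∀ x, W (fun y => signOf (F₁ y)) x = (2 : ℝ) ^ 4 * (u₁ x : ℝ))
    (hu₂ : ∀ y, W (fun x => signOf (F₂ x)) y = (2 : ℝ) ^ 4 * (u₂ y : ℝ))
    (κ₁ κ₂ : (Fin (6 + 6) → Bool) → Bool) (hκ₁ : IsDegLeFun 3 κ₁) (b₁ b₂ : Bool) (c₁ c₂ : Fin (6 + 6) → Bool)
    (h₁ : ∀ x, (((u₁ x - 4 * sZ (F₂ x) : ℤ)) : ℝ) = signOf b₁ * twist c₁ x * (1 - 4 * (if κ₁ x = true then 1 else 0)) + 8 * (v₁ x : ℝ))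
    (h₂ : ∀ y, (((u₂ y - 4 * sZ (F₁ y) : ℤ)) : ℝ) = signOf b₂ * twist c₂ y * (1 - 4 * (if κ₂ y = true then 1 else 0)) + 8 * (v₂ y : ℝ))
    (y : Fin (6 + 6) → Bool) :
    ∃ k : ℤ, ∑ x, (v₁ x : ℝ) * twist x y = 4 * (k : ℝ) := by
  classical
  have hm := topw_master F₁ F₂ u₁ u₂ v₁ v₂ hu₁ hu₂ κ₁ κ₂ b₁ b₂ c₁ c₂ h₁ h₂ y
  -- `Σ_{E₁} (−1)^{x·z} = 2048[z = 0] − 8 w(z)` with `W_{κ₁} = 16 w`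
  obtain ⟨w, hw⟩ := tw_base (n := 6 + 6) κ₁ hκ₁ 4 (by norm_num)
  have hsignOf_ind : ∀ b : Bool, signOf b = 1 - 2 * (if b = true then (1 : ℝ) else 0) := fun b => by
    cases b <;> norm_num [signOf]
  have hW : W (fun x => signOf (κ₁ x)) (bxor c₁ y) =
      ∑ x, twist x (bxor c₁ y) - 2 * ∑ x ∈ univ.filter (fun x => κ₁ x = true), twist x (bxor c₁ y) := by
    show ∑ x, signOf (κ₁ x) * twist x (bxor c₁ y) = _
    rw [sum_filter, mul_sum, ← sum_sub_distrib]
    refine sum_congr rfl fun x _ => ?_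
    rw [hsignOf_ind]; split_ifs <;> ring
  rw [hw, sum_twist_left] at hW
  have hδ : (if bxor c₁ y = zeroVec then (2 : ℝ) ^ (6 + 6) else 0) = 4096 * (if y = c₁ then 1 else 0) := by
    by_cases hy : y = c₁
    · rw [if_pos hy, if_pos ((bxor_eq_zeroVec_iff c₁ y).2 hy.symm)]; norm_num
    · rw [if_neg hy, if_neg (fun h => hy ((bxor_eq_zeroVec_iff c₁ y).1 h).symm)]; norm_num
  rw [hδ] at hW
  -- integer bookkeeping of the signs and indicators
  obtain ⟨T, hT1, hT⟩ : ∃ T : ℤ, (T = 1 ∨ T = -1) ∧ twist c₂ y = (T : ℝ) := by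
    rcases Literature.Computability.QuantumComplexity.Simon.twist_eq_one_or c₂ y with h | h
    · exact ⟨1, Or.inl rfl, by rw [h]; norm_num⟩
    · exact ⟨-1, Or.inr rfl, by rw [h]; norm_num⟩
  obtain ⟨m, hmV⟩ : ∃ m : ℤ, ∑ x, (v₁ x : ℝ) * twist x y = (m : ℝ) := by
    have ht : ∀ x, ∃ t : ℤ, twist x y = (t : ℝ) := fun x => by
      rcases Literature.Computability.QuantumComplexity.Simon.twist_eq_one_or x y with h | h
      · exact ⟨1, by rw [h]; norm_num⟩
      · exact ⟨-1, by rw [h]; norm_num⟩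
    choose t ht using ht
    exact ⟨∑ x, v₁ x * t x, by push_cast; exact sum_congr rfl fun x _ => by rw [ht x]⟩
  set dz : ℤ := if y = c₁ then 1 else 0 with hdz
  set Kz : ℤ := if κ₂ y = true then 1 else 0 with hKz
  have hdzR : (if y = c₁ then (1 : ℝ) else 0) = (dz : ℝ) := by simp only [hdz]; split_ifs <;> simp
  have hKzR : (if κ₂ y = true then (1 : ℝ) else 0) = (Kz : ℝ) := by simp only [hKz]; split_ifs <;> simp
  rw [hmV, hT, hdzR, hKzR, ← tp_sZ_cast b₁, ← tp_sZ_cast b₂] at hm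
  rw [hdzR] at hW
  have hs1 : ((sZ b₁ : ℤ) : ℝ) * ((sZ b₁ : ℤ) : ℝ) = 1 := by
    rcases tp_sZ_cases b₁ with h | h <;> rw [h] <;> norm_num
  refine ⟨sZ b₁ * (128 * dz - w (bxor c₁ y)) - 2 * sZ b₂ * T * (1 - 4 * Kz) - 16 * v₂ y, ?_⟩
  rw [hmV]
  push_cast
  linear_combination (-(sZ b₁ : ℝ) / 2) * hm + ((sZ b₁ : ℝ) / 4) * hW -
    ((m : ℝ) + 8 * (sZ b₂ : ℝ) * (T : ℝ) * (1 - 4 * (Kz : ℝ)) + 64 * (v₂ y : ℝ)) * hs1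

end Summit.QuantumAdvantage.QuantumAdvantage.Theorems.CubicForrelation.NearExactIsExact

end
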